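/-
Copyright (c) 2026 the pub-hodgecm-mathlib formalisation cell (harness21).  Prover seat hodgecm-mathlib-K2E1-p15 (g4), Track B ∕ K2-LIT, h413 = `stmt-HodgeConjecture-24833`, route `HCCMUnconditional`,
R90-TF section S8 «ContSpec-n½», the amplitude rows of ALL translates (S8 dealer R90-CS-plan (g3), rulings J-S8-U ∕ J-S8-TR = S8-R224 (1) ∕ S8-R235, 2026-09-05): ROAD A — the ADELIC dilation.
-/
import Summits.HodgeConjecture.HodgeConjecture.Theorems.K2E1CentreLineShellSumU3          -- ★ (K2E3-p14 ∕ K2E4 lineage): `lintegral_eq_ideleNorm_mul_lintegral_comp_mul` (pattern); brings ★ `K2E1BigCellHeisenbergDilationU3`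
                                                                                           --   (`bigCell_heisenberg_dilation_three`, `ideleNorm_rootScalar_three`, `ideleNorm_centralScalar_three`, `norm_multiplier_eq_rpow_three`)
import Summits.HodgeConjecture.HodgeConjecture.Theorems.K2E1UnipotentHaarNormalisationU3   -- ★ (ν-1) p857963: `inv_measure_smul_integral_eq_heisChart_traceZeroLine_three` (two-layer unfolding of `N(𝔸)`, any integrable `T`)
import HarnessLib

/-!
# K2·E1 ∕ R90·S8 — `K2E1ChiIntertwiningTranslateDilationU3`: THE UNIPOTENT INTEGRAL OF A TRANSLATED BOREL SECTION — for `g = u(X_u, θ t_u)·t·k`,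
# `(ν𝓕)⁻¹∫_{N(𝔸)} f(w₀ n g) dn = χ(d₂)‖d₂‖^z · ‖d₀⁻¹d₁‖_E⁻¹ · ‖Λ₂‖_F⁻¹ · (ν𝓕)⁻¹∫_{N(𝔸)} f(w₀ n k) dn`, and the prefactor has modulus `‖Λ₂‖_F^{Re z − 2} = H(g)^{2 − Re z}`

Cell `pub/hodgecm-mathlib`, crux h413 = `stmt-HodgeConjecture-24833`, route of record `HCCMUnconditional`; R90-TF section S8 «ContSpec-n½», the UNFOLDING ROAD for the amplitude rows
`Ag hAg hM hψ2` of ★ `R90S8ResGMidBlockLeResidualOfRecordU3.scalPackage_of_inputs` at EVERY translate `g` (ruling J-S8-U; J-S8-TR «ROAD A, the local translated-cell lemma is dropped»).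
THEOREMS ONLY (no `def`, no `instance`, no notation, no named-fact hypothesis, no `sorry`; default heartbeats); lane `--supports stmt-HodgeConjecture-24833 --as helper` (count-neutral).
Closes no socket.  Generic quadratic datum `(F, E, c)` (`[Algebra.IsQuadraticExtension F E]`, `c² = 1`, `cδ = −δ ≠ 0`).

THE MATHEMATICS ([MoeglinWaldspurger1995] II.1.6–II.1.7, IV.1.11; [Garrett2018] §2.9; [Rogawski1990] §1.10, §7.3; [CasselsFrohlichANT1967] XV Lemma 4.1.2).  Let `f` be a Borel section of
exponent `z` on `U(J₃)(𝔸_F)` (`f(b g) = χ(b₀₀)‖b₀₀‖^z f(g)`), `t = diag(d₀, d₁, d₂) ∈ T(𝔸_F)` with central scalar `Λ₂ ∈ 𝕀_F` (`(Λ₂)_E = d₀⁻¹d₂`, ★ `exists_centralScalar_three`),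
`u(X_u, θ t_u)` a Heisenberg element, `k` arbitrary.  ★ `bigCell_heisenberg_dilation_three` gives, pointwise on the chart,
`f(w₀·u(X, θ s)·(u(X_u, θ t_u)·t·k)) = m · f(w₀·u(λ₁(X + X_u), θ(Λ₂(s + t_u + y(X))))·k)`, `m = χ(d₂)‖d₂‖^z`, `λ₁ = d₀⁻¹d₁`, `y(X)` the Heisenberg cross term.  Unfolding both unipotent integrals
along the chart (★ (ν-1): `(ν𝓕)⁻¹∫_N T = μ_E(D_E)⁻¹∫_{𝔸_E} μ_F(D_F)⁻¹∫_{𝔸_F} T(u(X, θ s))`), the inner substitution `s ↦ s − t_u − y(X)` (translation invariance) then `s ↦ Λ₂⁻¹s`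
(`d(Λ s) = ‖Λ‖ ds`, §0), and the outer substitution `X ↦ X − X_u` then `X ↦ λ₁⁻¹X` give
  **`(ν𝓕)⁻¹∫_{N(𝔸)} f(w₀ n·(u t k)) dn = χ(d₂)‖d₂‖^z · ‖λ₁‖_E⁻¹ · ‖Λ₂‖_F⁻¹ · (ν𝓕)⁻¹∫_{N(𝔸)} f(w₀ n k) dn`** (§1).
Since `‖d₂‖ = ‖d₀‖⁻¹ = ‖Λ₂‖_F = ‖λ₁‖_E` (★ `ideleNorm_torus_three`, `ideleNorm_rootScalar_three`, `ideleNorm_centralScalar_three`), the prefactor IS `χ(d₂) · ‖d₀‖_E^{2 − z} =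
χ(d₂) · H(u t k)^{2 − z}` when `H(k) = 1` (§2–§3; ★ `borelHeight_unipotent_mul`, ★ `borelHeight_torus_mul'`) — so the `H(g)^{2−z}`-NORMALISED middle coefficient of the translate is the
UNITARY CONSTANT `χ(d₂)` times the `k`-translate's: the amplitude rows `hAg` ∕ `hM` ∕ `hψ2` of every translate follow from the `K`-translates' (★ (a-3) holomorphy, ★ (a-7) §1 uniform bound
for weights `|ω| ≤ 1` against the same local heights), uniformly in `g` (§3).
* §0 `integral_comp_idele_mul` — `∫ g(a·x) dμ(x) = ‖a‖⁻¹ • ∫ g dμ` on `𝔸_K` (Bochner form of ★ §1 of `K2E1CentreLineShellSumU3`; Tate's module), `integral_comp_idele_mul_add`.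
* §1 **`unipotentIntegral_translate_eq`** (HEAD) — the displayed identity, hypothesis-first on the Iwasawa triple `(u(X_u, θ t_u), t, k)` and on the `ν`-integrability of both integrands;
  **`unipotentIntegral_translate_eq'`** — the same for an arbitrary `u ∈ N(𝔸_F)`.
* §2 **`norm_translatePrefactor_eq`** (`‖prefactor‖ = ‖Λ₂‖_F^{Re z − 2}` for unitary `χ`), **`norm_translatePrefactor_mul_borelHeight_rpow_eq_one`** (`× H(u t k)^{Re z − 2} = 1` when `H(k) = 1`),
  **`translatePrefactor_eq_chi_mul_cpow`** (`prefactor = χ(d₂)·‖d₀‖_E^{2 − z}`, any `χ`).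
* §3 **`unipotentIntegral_translate_eq_chi_mul_borelHeight_cpow_mul`** (`Mid(u t k) = χ(d₂)·H(u t k)^{2−z}·Mid(k)` when `H(k) = 1`), **`normalisedMidCoefficient_eq_of_kTranslates`** (the `hψ2`-type
  row of every `g` from the `K`-translates', hypothesis-first on Iwasawa data `g = u(g)t(g)k(g)`), **`translate_rows_of_kTranslate_rows`** (`hAg` ∕ `hM` with `Ag g z := χ(d₂(t(g)))·A(k(g), z)`).
HONEST SCOPE.  NOT here: the Iwasawa decomposition `g = u·t·k` itself (★ adelic Iwasawa supplies `b·k`, ★ Borel = `N·T`), the (W) letter «the `k`-translate of a pure-tensor section is a pure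
tensor of weights `|ω_v| ≤ 1` against the same `Q_v`» (CS-p03's core (3)(ii)(iii) at `K_max`-translates), the `ν`-integrability of the translated integrands (Godement domination, ★
`K2E1IntertwiningGrowthU3` lineage) — all consumers' letters; this file is the change of variables only.
HONEST LABEL: HC_CM is proved only modulo the 7 printed citations (2 remaining named inputs: hLiu418 = `stmt-HodgeConjecture-24832`, h413 = `stmt-HodgeConjecture-24833`) until rung 0
closes; REL ≠ ★ ≠ BUILT; asserts no named fact, closes no socket; count-neutral; unconditional measure theory.

## References
* [MoeglinWaldspurger1995] C. Mœglin, J.-L. Waldspurger, *Spectral Decomposition and Eisenstein Series* (1995), II.1.6–II.1.7, IV.1.11.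
* [Garrett2018] P. Garrett, *Modern Analysis of Automorphic Forms by Example* (2018), §2.2, §2.9.
* [Rogawski1990] J. D. Rogawski, *Automorphic Representations of Unitary Groups in Three Variables* (1990), §1.10, §7.3.
* [CasselsFrohlichANT1967] J. W. S. Cassels, A. Fröhlich (eds.), *Algebraic Number Theory* (1967), Ch. XV Lemma 4.1.2 (Tate's module `d(ax) = ‖a‖dx`).
-/

set_option autoImplicit false
set_option linter.dupNamespace false  -- the mandated namespace repeats the summit's segment (`HodgeConjecture.HodgeConjecture`)

noncomputable section

open MeasureTheory Measure Filter Topology NumberField IsDedekindDomain MulAction Set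
open Literature.NumberTheory.Automorphic Literature.NumberTheory.Automorphic.UnitaryGroup Literature.NumberTheory.GaloisRepresentations
open Summit.HodgeConjecture.HodgeConjecture.Cruxes.H413.K2E1BorelEisensteinU
open Summit.HodgeConjecture.HodgeConjecture.Cruxes.H413.K2E1BigCellHeisenbergDilationU3
open Summit.HodgeConjecture.HodgeConjecture.Cruxes.H413.K2E1UnipotentHaarNormalisationU3 (inv_measure_smul_integral_eq_heisChart_traceZeroLine_three)
open scoped ENNReal NNReal Pointwise

namespace Summit.HodgeConjecture.HodgeConjecture.Cruxes.H413.K2E1ChiIntertwiningTranslateDilationU3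

/-! ## §0 Tate's module for Bochner integrals on `𝔸_K`: `∫ g(a·x) dμ = ‖a‖⁻¹ • ∫ g dμ`, `∫ g(a·x + b) dμ = ‖a‖⁻¹ • ∫ g dμ` -/

section Module

variable (K : Type) [Field K] [NumberField K] [MeasurableSpace (AdeleRing (𝓞 K) K)] [BorelSpace (AdeleRing (𝓞 K) K)]
  (μ : Measure (AdeleRing (𝓞 K) K)) [μ.IsAddHaarMeasure]

/-- **`∫ g(a·x) dμ(x) = ‖a‖_𝔸⁻¹ • ∫ g dμ`** for an idele `a` and an additive Haar measure `μ` on `𝔸_K`, ANY `g` (no integrability needed: `x ↦ a·x` is a measurable equivalence with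
`(a·)_*μ = ‖a‖⁻¹μ`, ★ `AdeleRing.addHaar_smul_eq_ideleNorm_mul`). [cite: CasselsFrohlichANT1967, Ch. XV Lemma 4.1.2] -/
theorem integral_comp_idele_mul (a : (AdeleRing (𝓞 K) K)ˣ) (g : AdeleRing (𝓞 K) K → ℂ) :
    ∫ x, g ((a : AdeleRing (𝓞 K) K) * x) ∂μ = (((IdeleClassGroup.ideleNorm K a)⁻¹ : ℝ≥0) : ℝ) • ∫ x, g x ∂μ := by
  haveI : LocallyCompactSpace (AdeleRing (𝓞 K) K) := locallyCompactSpace_adeleRing' K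
  haveI : SecondCountableTopology (AdeleRing (𝓞 K) K) := secondCountableTopology_adeleRing K
  haveI : μ.Regular := by infer_instance
  have hmeas : Measurable fun x : AdeleRing (𝓞 K) K => (a : AdeleRing (𝓞 K) K) * x := measurable_const_mul _
  have hmap : μ.map (fun x : AdeleRing (𝓞 K) K => (a : AdeleRing (𝓞 K) K) * x) = ((IdeleClassGroup.ideleNorm K a : ℝ≥0∞)⁻¹) • μ := by
    ext s hs
    rw [Measure.map_apply hmeas hs, Measure.smul_apply, smul_eq_mul]
    have hpre : (fun x : AdeleRing (𝓞 K) K => (a : AdeleRing (𝓞 K) K) * x) ⁻¹' s = (a⁻¹ : (AdeleRing (𝓞 K) K)ˣ) • s := by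
      ext x
      rw [Set.mem_preimage, Set.mem_smul_set_iff_inv_smul_mem, inv_inv, Units.smul_def, smul_eq_mul]
    rw [hpre, AdeleRing.addHaar_smul_eq_ideleNorm_mul K μ a⁻¹ s, map_inv, ENNReal.coe_inv (ideleNorm_ne_zero a)]
  let e : AdeleRing (𝓞 K) K ≃ᵐ AdeleRing (𝓞 K) K :=
    { toEquiv := a.mulLeft, measurable_toFun := hmeas, measurable_invFun := measurable_const_mul _ }
  have he : (⇑e) = fun x : AdeleRing (𝓞 K) K => (a : AdeleRing (𝓞 K) K) * x := rfl
  calc ∫ x, g ((a : AdeleRing (𝓞 K) K) * x) ∂μ = ∫ x, g (e x) ∂μ := rfl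
    _ = ∫ y, g y ∂(μ.map e) := (integral_map_equiv e g).symm
    _ = ∫ y, g y ∂(((IdeleClassGroup.ideleNorm K a : ℝ≥0∞)⁻¹) • μ) := by rw [he, hmap]
    _ = (((IdeleClassGroup.ideleNorm K a)⁻¹ : ℝ≥0) : ℝ) • ∫ x, g x ∂μ := by
        rw [integral_smul_measure, ← ENNReal.coe_inv (ideleNorm_ne_zero a), ENNReal.coe_toReal]

/-- **`∫ g(a·(x + b)) dμ(x) = ‖a‖_𝔸⁻¹ • ∫ g dμ`** (translation invariance, then §0's module). [cite: CasselsFrohlichANT1967, Ch. XV Lemma 4.1.2] -/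
theorem integral_comp_idele_mul_add (a : (AdeleRing (𝓞 K) K)ˣ) (b : AdeleRing (𝓞 K) K) (g : AdeleRing (𝓞 K) K → ℂ) :
    ∫ x, g ((a : AdeleRing (𝓞 K) K) * (x + b)) ∂μ = (((IdeleClassGroup.ideleNorm K a)⁻¹ : ℝ≥0) : ℝ) • ∫ x, g x ∂μ := by
  rw [integral_add_right_eq_self (μ := μ) (fun x => g ((a : AdeleRing (𝓞 K) K) * x)) b]
  exact integral_comp_idele_mul K μ a g

end Module

/-! ## §1 The unipotent integral of a translated Borel section -/

section Translate

variable {F E : Type} [Field F] [NumberField F] [Field E] [NumberField E] [Algebra F E] [Algebra.IsQuadraticExtension F E] {c : E ≃ₐ[F] E}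
  {δ : E}
  [MeasurableSpace (AdeleRing (𝓞 E) E)] [BorelSpace (AdeleRing (𝓞 E) E)]
  [MeasurableSpace (AdeleRing (𝓞 F) F)] [BorelSpace (AdeleRing (𝓞 F) F)]
  [MeasurableSpace ↥(adelicUnipotent F E c 3)] [BorelSpace ↥(adelicUnipotent F E c 3)]

/-- **HEAD — THE UNIPOTENT INTEGRAL OF THE `u·t·k`-TRANSLATE IS A SCALAR MULTIPLE OF THE `k`-TRANSLATE'S**: for `c² = 1`, `cδ = −δ ≠ 0`, additive Haar measures `μ_F`, `μ_E`, a Haar measure `ν`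
on `N(𝔸_F)` with an `N(F)`-fundamental domain `𝓕`, a Borel section `f` of exponent `z` (`f(b g) = χ(b₀₀)‖b₀₀‖^z f(g)`), a torus element `t = diag(d₀, d₁, d₂)` with central scalar `Λ₂`
(`(Λ₂)_E = d₀⁻¹d₂`), a Heisenberg element `u(X_u, θ t_u)` and ANY `k`, with both integrands `ν`-integrable:
`(ν𝓕)⁻¹ • ∫_N f(w₀·n·(u(X_u, θ t_u)·t·k)) dν = (χ(d₂)‖d₂‖^z · ‖d₀⁻¹d₁‖_E⁻¹ · ‖Λ₂‖_F⁻¹) · (ν𝓕)⁻¹ • ∫_N f(w₀·n·k) dν`.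
Proof: ★ (ν-1) on both sides, ★ `bigCell_heisenberg_dilation_three` pointwise, then §0 twice (inner line `𝔸_F`, outer `𝔸_E`) after the two translations.
[cite: MoeglinWaldspurger1995, II.1.7, IV.1.11] [cite: Garrett2018, §2.9] [cite: Rogawski1990, §1.10, §7.3] [cite: CasselsFrohlichANT1967, Ch. XV Lemma 4.1.2] -/
theorem unipotentIntegral_translate_eq (hc : c * c = 1) (hcδ : c δ = -δ) (hδ : δ ≠ 0)
    (μF : Measure (AdeleRing (𝓞 F) F)) [μF.IsAddHaarMeasure] (μE : Measure (AdeleRing (𝓞 E) E)) [μE.IsAddHaarMeasure]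
    (ν : Measure ↥(adelicUnipotent F E c 3)) [ν.IsHaarMeasure]
    {𝓕 : Set ↥(adelicUnipotent F E c 3)} (h𝓕 : IsFundamentalDomain ↥(rationalUnipotent F E c 3) 𝓕 ν)
    (χ : HeckeCharacter E) (z : ℂ) {f : (quasiSplit F E c 3).Adelic → ℂ}
    (hf : ∀ (b g : (quasiSplit F E c 3).Adelic) (hb : b ∈ borelAdelic F E c 3),
      f (b * g) = ((χ (diagUnit hb 0) : ℂˣ) : ℂ) * ((ideleNorm (diagUnit hb 0) : ℝ) : ℂ) ^ z * f g)
    (t : ↥(torusInBorel F E c 3)) (Λ₂ : (AdeleRing (𝓞 F) F)ˣ)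
    (hΛ₂ : ((AdeleRing.ideleBaseChange F E Λ₂ : (AdeleRing (𝓞 E) E)ˣ) : AdeleRing (𝓞 E) E) =
      (((diagUnit (t : borelAdelic F E c 3).2 0)⁻¹ * diagUnit (t : borelAdelic F E c 3).2 2 : (AdeleRing (𝓞 E) E)ˣ) : AdeleRing (𝓞 E) E))
    (Xu : AdeleRing (𝓞 E) E) (tu : AdeleRing (𝓞 F) F) (k : (quasiSplit F E c 3).Adelic)
    (hT₁ : Integrable (fun n : ↥(adelicUnipotent F E c 3) =>
      f ((quasiSplit F E c 3).toAdelic (weylLongU (c : E →+* E) (rfl : (StdForm.antidiagonal 3).over E = (StdForm.antidiagonal 3).over E)) * (n : (quasiSplit F E c 3).Adelic) *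
        (((heisChart hc (Xu, traceZeroLine F E c hcδ hδ tu) : adelicUnipotent F E c 3) : (quasiSplit F E c 3).Adelic) * ((t : borelAdelic F E c 3) : (quasiSplit F E c 3).Adelic) * k))) ν)
    (hT₂ : Integrable (fun n : ↥(adelicUnipotent F E c 3) =>
      f ((quasiSplit F E c 3).toAdelic (weylLongU (c : E →+* E) (rfl : (StdForm.antidiagonal 3).over E = (StdForm.antidiagonal 3).over E)) * (n : (quasiSplit F E c 3).Adelic) * k)) ν) :
    ((ν 𝓕).toReal⁻¹ : ℝ) • ∫ n : ↥(adelicUnipotent F E c 3),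
        f ((quasiSplit F E c 3).toAdelic (weylLongU (c : E →+* E) (rfl : (StdForm.antidiagonal 3).over E = (StdForm.antidiagonal 3).over E)) * (n : (quasiSplit F E c 3).Adelic) *
          (((heisChart hc (Xu, traceZeroLine F E c hcδ hδ tu) : adelicUnipotent F E c 3) : (quasiSplit F E c 3).Adelic) * ((t : borelAdelic F E c 3) : (quasiSplit F E c 3).Adelic) * k)) ∂ν =
      (((χ (diagUnit (t : borelAdelic F E c 3).2 2) : ℂˣ) : ℂ) * ((ideleNorm (diagUnit (t : borelAdelic F E c 3).2 2) : ℝ) : ℂ) ^ z *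
          ((((IdeleClassGroup.ideleNorm E ((diagUnit (t : borelAdelic F E c 3).2 0)⁻¹ * diagUnit (t : borelAdelic F E c 3).2 1))⁻¹ : ℝ≥0) : ℝ) : ℂ) *
          ((((IdeleClassGroup.ideleNorm F Λ₂)⁻¹ : ℝ≥0) : ℝ) : ℂ)) *
        (((ν 𝓕).toReal⁻¹ : ℝ) • ∫ n : ↥(adelicUnipotent F E c 3),
          f ((quasiSplit F E c 3).toAdelic (weylLongU (c : E →+* E) (rfl : (StdForm.antidiagonal 3).over E = (StdForm.antidiagonal 3).over E)) * (n : (quasiSplit F E c 3).Adelic) * k) ∂ν) := by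
  -- notation-free abbreviations (as `set`s) for the long tokens
  set w₀ : (quasiSplit F E c 3).Adelic := (quasiSplit F E c 3).toAdelic (weylLongU (c : E →+* E) (rfl : (StdForm.antidiagonal 3).over E = (StdForm.antidiagonal 3).over E))
  set g₁ : (quasiSplit F E c 3).Adelic := ((heisChart hc (Xu, traceZeroLine F E c hcδ hδ tu) : adelicUnipotent F E c 3) : (quasiSplit F E c 3).Adelic) *
    ((t : borelAdelic F E c 3) : (quasiSplit F E c 3).Adelic) * k
  set m : ℂ := ((χ (diagUnit (t : borelAdelic F E c 3).2 2) : ℂˣ) : ℂ) * ((ideleNorm (diagUnit (t : borelAdelic F E c 3).2 2) : ℝ) : ℂ) ^ z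
  set lam : (AdeleRing (𝓞 E) E)ˣ := (diagUnit (t : borelAdelic F E c 3).2 0)⁻¹ * diagUnit (t : borelAdelic F E c 3).2 1
  -- both sides unfolded along the chart (★ (ν-1))
  rw [inv_measure_smul_integral_eq_heisChart_traceZeroLine_three (hcδ := hcδ) (hδ := hδ) hc μF μE ν h𝓕 hT₁,
    inv_measure_smul_integral_eq_heisChart_traceZeroLine_three (hcδ := hcδ) (hδ := hδ) hc μF μE ν h𝓕 hT₂]
  -- the chart integrand of the translate, by ★ dilation: `m · f(w₀ · u(lam·(X + Xu), θ(Λ₂·(s + c X))) · k)`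
  have hdil : ∀ (X : AdeleRing (𝓞 E) E) (s : AdeleRing (𝓞 F) F),
      f (w₀ * ((heisChart hc (X, traceZeroLine F E c hcδ hδ s) : adelicUnipotent F E c 3) : (quasiSplit F E c 3).Adelic) * g₁) =
        m * f (w₀ * ((heisChart hc ((lam : AdeleRing (𝓞 E) E) * (X + Xu),
          traceZeroLine F E c hcδ hδ ((Λ₂ : AdeleRing (𝓞 F) F) * (s + (tu + (traceZeroLine F E c hcδ hδ).symm
            (coordY hc (heisChart hc (X, (0 : traceZeroAdele F E c)) * heisChart hc (Xu, (0 : traceZeroAdele F E c)))))))) : adelicUnipotent F E c 3) : (quasiSplit F E c 3).Adelic) * k) := by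
    intro X s
    have h := bigCell_heisenberg_dilation_three hc hcδ hδ χ z hf t Λ₂ hΛ₂ Xu tu k X s
    simp only [sub_neg_eq_add] at h
    exact h
  -- the inner integral over the line: translation by `tu + y(X)`, then the module of `Λ₂`
  have hinner : ∀ X : AdeleRing (𝓞 E) E,
      ∫ s, f (w₀ * ((heisChart hc (X, traceZeroLine F E c hcδ hδ s) : adelicUnipotent F E c 3) : (quasiSplit F E c 3).Adelic) * g₁) ∂μF =
        (m * ((((IdeleClassGroup.ideleNorm F Λ₂)⁻¹ : ℝ≥0) : ℝ) : ℂ)) *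
          ∫ s, f (w₀ * ((heisChart hc ((lam : AdeleRing (𝓞 E) E) * (X + Xu), traceZeroLine F E c hcδ hδ s) : adelicUnipotent F E c 3) : (quasiSplit F E c 3).Adelic) * k) ∂μF := by
    intro X
    simp only [hdil X]
    rw [integral_const_mul, integral_comp_idele_mul_add F μF Λ₂ _ (fun s => f (w₀ * ((heisChart hc ((lam : AdeleRing (𝓞 E) E) * (X + Xu), traceZeroLine F E c hcδ hδ s) : adelicUnipotent F E c 3) : (quasiSplit F E c 3).Adelic) * k)),
      Complex.real_smul]
    ring
  -- the outer integral over `𝔸_E`: translation by `Xu`, then the module of `lam`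
  have houter : ∫ X, ((μF (adeleFundamentalDomain F)).toReal⁻¹ : ℂ) * ∫ s, f (w₀ * ((heisChart hc (X, traceZeroLine F E c hcδ hδ s) : adelicUnipotent F E c 3) : (quasiSplit F E c 3).Adelic) * g₁) ∂μF ∂μE =
      (m * ((((IdeleClassGroup.ideleNorm F Λ₂)⁻¹ : ℝ≥0) : ℝ) : ℂ) * ((((IdeleClassGroup.ideleNorm E lam)⁻¹ : ℝ≥0) : ℝ) : ℂ)) *
        ∫ X, ((μF (adeleFundamentalDomain F)).toReal⁻¹ : ℂ) * ∫ s, f (w₀ * ((heisChart hc (X, traceZeroLine F E c hcδ hδ s) : adelicUnipotent F E c 3) : (quasiSplit F E c 3).Adelic) * k) ∂μF ∂μE := by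
    simp only [hinner]
    have hrw : ∀ X : AdeleRing (𝓞 E) E, ((μF (adeleFundamentalDomain F)).toReal⁻¹ : ℂ) * ((m * ((((IdeleClassGroup.ideleNorm F Λ₂)⁻¹ : ℝ≥0) : ℝ) : ℂ)) *
        ∫ s, f (w₀ * ((heisChart hc ((lam : AdeleRing (𝓞 E) E) * (X + Xu), traceZeroLine F E c hcδ hδ s) : adelicUnipotent F E c 3) : (quasiSplit F E c 3).Adelic) * k) ∂μF) =
        (m * ((((IdeleClassGroup.ideleNorm F Λ₂)⁻¹ : ℝ≥0) : ℝ) : ℂ)) * (fun Y : AdeleRing (𝓞 E) E => ((μF (adeleFundamentalDomain F)).toReal⁻¹ : ℂ) *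
          ∫ s, f (w₀ * ((heisChart hc (Y, traceZeroLine F E c hcδ hδ s) : adelicUnipotent F E c 3) : (quasiSplit F E c 3).Adelic) * k) ∂μF) ((lam : AdeleRing (𝓞 E) E) * (X + Xu)) :=
      fun X => by ring
    simp only [hrw]
    rw [integral_const_mul, integral_comp_idele_mul_add E μE lam Xu (fun Y : AdeleRing (𝓞 E) E => ((μF (adeleFundamentalDomain F)).toReal⁻¹ : ℂ) *
      ∫ s, f (w₀ * ((heisChart hc (Y, traceZeroLine F E c hcδ hδ s) : adelicUnipotent F E c 3) : (quasiSplit F E c 3).Adelic) * k) ∂μF), Complex.real_smul]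
    ring
  rw [houter]
  ring

/-- **§1 for an ARBITRARY `u ∈ N(𝔸_F)`** (`u = u(X_u, θ t_u)` with `X_u = coordX u`, `t_u = θ⁻¹(coordY u)`, ★ `heisChart_coord`):
`(ν𝓕)⁻¹ • ∫_N f(w₀·n·(u·t·k)) dν = (χ(d₂)‖d₂‖^z · ‖d₀⁻¹d₁‖_E⁻¹ · ‖Λ₂‖_F⁻¹) · (ν𝓕)⁻¹ • ∫_N f(w₀·n·k) dν`.
[cite: MoeglinWaldspurger1995, II.1.7, IV.1.11] [cite: Garrett2018, §2.9] [cite: Rogawski1990, §1.10, §7.3] -/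
theorem unipotentIntegral_translate_eq' (hc : c * c = 1) (hcδ : c δ = -δ) (hδ : δ ≠ 0)
    (μF : Measure (AdeleRing (𝓞 F) F)) [μF.IsAddHaarMeasure] (μE : Measure (AdeleRing (𝓞 E) E)) [μE.IsAddHaarMeasure]
    (ν : Measure ↥(adelicUnipotent F E c 3)) [ν.IsHaarMeasure]
    {𝓕 : Set ↥(adelicUnipotent F E c 3)} (h𝓕 : IsFundamentalDomain ↥(rationalUnipotent F E c 3) 𝓕 ν)
    (χ : HeckeCharacter E) (z : ℂ) {f : (quasiSplit F E c 3).Adelic → ℂ}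
    (hf : ∀ (b g : (quasiSplit F E c 3).Adelic) (hb : b ∈ borelAdelic F E c 3),
      f (b * g) = ((χ (diagUnit hb 0) : ℂˣ) : ℂ) * ((ideleNorm (diagUnit hb 0) : ℝ) : ℂ) ^ z * f g)
    (t : ↥(torusInBorel F E c 3)) (Λ₂ : (AdeleRing (𝓞 F) F)ˣ)
    (hΛ₂ : ((AdeleRing.ideleBaseChange F E Λ₂ : (AdeleRing (𝓞 E) E)ˣ) : AdeleRing (𝓞 E) E) =
      (((diagUnit (t : borelAdelic F E c 3).2 0)⁻¹ * diagUnit (t : borelAdelic F E c 3).2 2 : (AdeleRing (𝓞 E) E)ˣ) : AdeleRing (𝓞 E) E))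
    (u : ↥(adelicUnipotent F E c 3)) (k : (quasiSplit F E c 3).Adelic)
    (hT₁ : Integrable (fun n : ↥(adelicUnipotent F E c 3) =>
      f ((quasiSplit F E c 3).toAdelic (weylLongU (c : E →+* E) (rfl : (StdForm.antidiagonal 3).over E = (StdForm.antidiagonal 3).over E)) * (n : (quasiSplit F E c 3).Adelic) *
        ((u : (quasiSplit F E c 3).Adelic) * ((t : borelAdelic F E c 3) : (quasiSplit F E c 3).Adelic) * k))) ν)
    (hT₂ : Integrable (fun n : ↥(adelicUnipotent F E c 3) =>
      f ((quasiSplit F E c 3).toAdelic (weylLongU (c : E →+* E) (rfl : (StdForm.antidiagonal 3).over E = (StdForm.antidiagonal 3).over E)) * (n : (quasiSplit F E c 3).Adelic) * k)) ν) :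
    ((ν 𝓕).toReal⁻¹ : ℝ) • ∫ n : ↥(adelicUnipotent F E c 3),
        f ((quasiSplit F E c 3).toAdelic (weylLongU (c : E →+* E) (rfl : (StdForm.antidiagonal 3).over E = (StdForm.antidiagonal 3).over E)) * (n : (quasiSplit F E c 3).Adelic) *
          ((u : (quasiSplit F E c 3).Adelic) * ((t : borelAdelic F E c 3) : (quasiSplit F E c 3).Adelic) * k)) ∂ν =
      (((χ (diagUnit (t : borelAdelic F E c 3).2 2) : ℂˣ) : ℂ) * ((ideleNorm (diagUnit (t : borelAdelic F E c 3).2 2) : ℝ) : ℂ) ^ z *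
          ((((IdeleClassGroup.ideleNorm E ((diagUnit (t : borelAdelic F E c 3).2 0)⁻¹ * diagUnit (t : borelAdelic F E c 3).2 1))⁻¹ : ℝ≥0) : ℝ) : ℂ) *
          ((((IdeleClassGroup.ideleNorm F Λ₂)⁻¹ : ℝ≥0) : ℝ) : ℂ)) *
        (((ν 𝓕).toReal⁻¹ : ℝ) • ∫ n : ↥(adelicUnipotent F E c 3),
          f ((quasiSplit F E c 3).toAdelic (weylLongU (c : E →+* E) (rfl : (StdForm.antidiagonal 3).over E = (StdForm.antidiagonal 3).over E)) * (n : (quasiSplit F E c 3).Adelic) * k) ∂ν) := by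
  obtain ⟨p, rfl⟩ : ∃ p : AdeleRing (𝓞 E) E × traceZeroAdele F E c, heisChart hc p = u := ⟨_, heisChart_coord hc u⟩
  obtain ⟨Xu, y⟩ := p
  obtain ⟨tu, rfl⟩ : ∃ tu : AdeleRing (𝓞 F) F, traceZeroLine F E c hcδ hδ tu = y := ⟨_, ContinuousAddEquiv.apply_symm_apply _ _⟩
  exact unipotentIntegral_translate_eq hc hcδ hδ μF μE ν h𝓕 χ z hf t Λ₂ hΛ₂ Xu tu k hT₁ hT₂

end Translate

/-! ## §2 The modulus of the prefactor -/

section Prefactor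

variable {F E : Type} [Field F] [NumberField F] [Field E] [NumberField E] [Algebra F E] [Algebra.IsQuadraticExtension F E] {c : E ≃ₐ[F] E}

/-- **`‖χ(d₂)‖d₂‖^z · ‖d₀⁻¹d₁‖_E⁻¹ · ‖Λ₂‖_F⁻¹‖ = ‖Λ₂‖_F^{Re z − 2}`** for unitary `χ` (★ `norm_multiplier_eq_rpow_three`: `‖m‖ = ‖Λ₂‖^{Re z}` and `‖d₀⁻¹d₁‖_E = ‖Λ₂‖_F`).
[cite: Garrett2018, §2.9] [cite: Rogawski1990, §1.10] -/
theorem norm_translatePrefactor_eq (χ : HeckeCharacter E) (hχ : χ.IsUnitary) (z : ℂ) (t : ↥(torusInBorel F E c 3)) (Λ₂ : (AdeleRing (𝓞 F) F)ˣ)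
    (hΛ₂ : ((AdeleRing.ideleBaseChange F E Λ₂ : (AdeleRing (𝓞 E) E)ˣ) : AdeleRing (𝓞 E) E) =
      (((diagUnit (t : borelAdelic F E c 3).2 0)⁻¹ * diagUnit (t : borelAdelic F E c 3).2 2 : (AdeleRing (𝓞 E) E)ˣ) : AdeleRing (𝓞 E) E)) :
    ‖((χ (diagUnit (t : borelAdelic F E c 3).2 2) : ℂˣ) : ℂ) * ((ideleNorm (diagUnit (t : borelAdelic F E c 3).2 2) : ℝ) : ℂ) ^ z *
        ((((IdeleClassGroup.ideleNorm E ((diagUnit (t : borelAdelic F E c 3).2 0)⁻¹ * diagUnit (t : borelAdelic F E c 3).2 1))⁻¹ : ℝ≥0) : ℝ) : ℂ) *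
        ((((IdeleClassGroup.ideleNorm F Λ₂)⁻¹ : ℝ≥0) : ℝ) : ℂ)‖ = ((IdeleClassGroup.ideleNorm F Λ₂ : ℝ≥0) : ℝ) ^ (z.re - 2) := by
  obtain ⟨hm, hL⟩ := norm_multiplier_eq_rpow_three χ hχ z t Λ₂ hΛ₂
  have hΛpos : 0 < ((IdeleClassGroup.ideleNorm F Λ₂ : ℝ≥0) : ℝ) := by exact_mod_cast pos_iff_ne_zero.2 (ideleNorm_ne_zero Λ₂)
  rw [norm_mul, norm_mul, hm, Complex.norm_real, Complex.norm_real, NNReal.coe_inv, NNReal.coe_inv, hL, Real.norm_of_nonneg (inv_nonneg.2 hΛpos.le),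
    Real.rpow_sub hΛpos, Real.rpow_two, sq, div_eq_mul_inv, mul_inv, mul_assoc]

/-- **THE `H^{z−2}`-NORMALISED PREFACTOR HAS MODULUS ONE**: for `g = u·t·k` with `u ∈ N(𝔸)` and `H(k) = 1`, `H(g) = ‖d₀‖_E = ‖Λ₂‖_F⁻¹` (★ `borelHeight_unipotent_mul`, ★ `borelHeight_torus_mul'`,
★ `ideleNorm_centralScalar_three`), so `‖prefactor‖ · H(g)^{Re z − 2} = 1` — the amplitude of the translate's `H(g)^{z−2}`-normalised middle coefficient is a modulus-one multiple of the
`k`-translate's. [cite: Garrett2018, §2.2, §2.9] [cite: MoeglinWaldspurger1995, II.1.7] -/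
theorem norm_translatePrefactor_mul_borelHeight_rpow_eq_one (χ : HeckeCharacter E) (hχ : χ.IsUnitary) (z : ℂ) (t : ↥(torusInBorel F E c 3)) (Λ₂ : (AdeleRing (𝓞 F) F)ˣ)
    (hΛ₂ : ((AdeleRing.ideleBaseChange F E Λ₂ : (AdeleRing (𝓞 E) E)ˣ) : AdeleRing (𝓞 E) E) =
      (((diagUnit (t : borelAdelic F E c 3).2 0)⁻¹ * diagUnit (t : borelAdelic F E c 3).2 2 : (AdeleRing (𝓞 E) E)ˣ) : AdeleRing (𝓞 E) E))
    {u : (quasiSplit F E c 3).Adelic} (hu : u ∈ adelicUnipotent F E c 3) {k : (quasiSplit F E c 3).Adelic} (hk : borelHeight k = 1) :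
    ‖((χ (diagUnit (t : borelAdelic F E c 3).2 2) : ℂˣ) : ℂ) * ((ideleNorm (diagUnit (t : borelAdelic F E c 3).2 2) : ℝ) : ℂ) ^ z *
        ((((IdeleClassGroup.ideleNorm E ((diagUnit (t : borelAdelic F E c 3).2 0)⁻¹ * diagUnit (t : borelAdelic F E c 3).2 1))⁻¹ : ℝ≥0) : ℝ) : ℂ) *
        ((((IdeleClassGroup.ideleNorm F Λ₂)⁻¹ : ℝ≥0) : ℝ) : ℂ)‖ *
      ((borelHeight (u * ((t : borelAdelic F E c 3) : (quasiSplit F E c 3).Adelic) * k) : ℝ≥0) : ℝ) ^ (z.re - 2) = 1 := by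
  have hΛpos : 0 < ((IdeleClassGroup.ideleNorm F Λ₂ : ℝ≥0) : ℝ) := by exact_mod_cast pos_iff_ne_zero.2 (ideleNorm_ne_zero Λ₂)
  -- `H(u t k) = ‖d₀‖ = ‖Λ₂‖⁻¹`
  have hH : borelHeight (u * ((t : borelAdelic F E c 3) : (quasiSplit F E c 3).Adelic) * k) = (IdeleClassGroup.ideleNorm F Λ₂)⁻¹ := by
    rw [mul_assoc, borelHeight_unipotent_mul hu, borelHeight_torus_mul' (glDiagonal_diagUnit_torus t) k, hk, mul_one, ideleNorm_centralScalar_three t Λ₂ hΛ₂, inv_inv]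
  rw [norm_translatePrefactor_eq χ hχ z t Λ₂ hΛ₂, hH, NNReal.coe_inv, ← Real.mul_rpow hΛpos.le (inv_nonneg.2 hΛpos.le), mul_inv_cancel₀ hΛpos.ne',
    Real.one_rpow]

/-- **THE PREFACTOR IS `χ(d₂) · ‖d₀‖_E^{2 − z}` EXACTLY** (`‖d₂‖ = ‖d₀‖⁻¹`, `‖d₀⁻¹d₁‖_E = ‖d₀‖⁻¹`, `‖Λ₂‖_F = ‖d₀‖⁻¹`: ★ `ideleNorm_torus_three`, ★ `ideleNorm_rootScalar_three`,
★ `ideleNorm_centralScalar_three`); no unitarity needed. [cite: Garrett2018, §2.9] [cite: Rogawski1990, §1.10] -/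
theorem translatePrefactor_eq_chi_mul_cpow (χ : HeckeCharacter E) (z : ℂ) (t : ↥(torusInBorel F E c 3)) (Λ₂ : (AdeleRing (𝓞 F) F)ˣ)
    (hΛ₂ : ((AdeleRing.ideleBaseChange F E Λ₂ : (AdeleRing (𝓞 E) E)ˣ) : AdeleRing (𝓞 E) E) =
      (((diagUnit (t : borelAdelic F E c 3).2 0)⁻¹ * diagUnit (t : borelAdelic F E c 3).2 2 : (AdeleRing (𝓞 E) E)ˣ) : AdeleRing (𝓞 E) E)) :
    ((χ (diagUnit (t : borelAdelic F E c 3).2 2) : ℂˣ) : ℂ) * ((ideleNorm (diagUnit (t : borelAdelic F E c 3).2 2) : ℝ) : ℂ) ^ z *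
        ((((IdeleClassGroup.ideleNorm E ((diagUnit (t : borelAdelic F E c 3).2 0)⁻¹ * diagUnit (t : borelAdelic F E c 3).2 1))⁻¹ : ℝ≥0) : ℝ) : ℂ) *
        ((((IdeleClassGroup.ideleNorm F Λ₂)⁻¹ : ℝ≥0) : ℝ) : ℂ) =
      ((χ (diagUnit (t : borelAdelic F E c 3).2 2) : ℂˣ) : ℂ) * (((IdeleClassGroup.ideleNorm E (diagUnit (t : borelAdelic F E c 3).2 0) : ℝ≥0) : ℝ) : ℂ) ^ ((2 : ℂ) - z) := by
  have hr : 0 < ((IdeleClassGroup.ideleNorm E (diagUnit (t : borelAdelic F E c 3).2 0) : ℝ≥0) : ℝ) := by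
    exact_mod_cast pos_iff_ne_zero.2 (ideleNorm_ne_zero (diagUnit (t : borelAdelic F E c 3).2 0))
  have hr0 : (((IdeleClassGroup.ideleNorm E (diagUnit (t : borelAdelic F E c 3).2 0) : ℝ≥0) : ℝ) : ℂ) ≠ 0 := by exact_mod_cast hr.ne'
  have harg : (((IdeleClassGroup.ideleNorm E (diagUnit (t : borelAdelic F E c 3).2 0) : ℝ≥0) : ℝ) : ℂ).arg ≠ Real.pi := by
    rw [Complex.arg_ofReal_of_nonneg hr.le]; exact Real.pi_ne_zero.symm
  rw [← coe_ideleNorm, (ideleNorm_torus_three t).2, ideleNorm_rootScalar_three, inv_inv, ideleNorm_centralScalar_three t Λ₂ hΛ₂, inv_inv, NNReal.coe_inv,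
    Complex.ofReal_inv, Complex.inv_cpow _ _ harg, ← Complex.cpow_neg, show (2 : ℂ) - z = -z + 1 + 1 by ring, Complex.cpow_add _ _ hr0, Complex.cpow_add _ _ hr0,
    Complex.cpow_one]
  ring

end Prefactor

/-! ## §3 The `H^{2−z}`-normalised middle coefficient of a translate, and the amplitude rows of ALL translates from the `K`-translates' -/

section Rows

variable {F E : Type} [Field F] [NumberField F] [Field E] [NumberField E] [Algebra F E] [Algebra.IsQuadraticExtension F E] {c : E ≃ₐ[F] E}
  {δ : E}
  [MeasurableSpace (AdeleRing (𝓞 E) E)] [BorelSpace (AdeleRing (𝓞 E) E)]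
  [MeasurableSpace (AdeleRing (𝓞 F) F)] [BorelSpace (AdeleRing (𝓞 F) F)]
  [MeasurableSpace ↥(adelicUnipotent F E c 3)] [BorelSpace ↥(adelicUnipotent F E c 3)]

/-- **THE MIDDLE COEFFICIENT OF THE `u·t·k`-TRANSLATE IS `χ(d₂)·H(u t k)^{2−z}` TIMES THE `k`-TRANSLATE'S** when `H(k) = 1` (§1′, `translatePrefactor_eq_chi_mul_cpow`, ★
`exists_centralScalar_three`, `H(u t k) = ‖d₀‖_E` by ★ `borelHeight_unipotent_mul` ∕ ★ `borelHeight_torus_mul'`): the `H(g)^{2−z}`-normalised middle coefficient of the translate is the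
UNITARY CONSTANT `χ(d₂)` times the `k`-translate's. [cite: MoeglinWaldspurger1995, II.1.7, IV.1.11] [cite: Garrett2018, §2.2, §2.9] [cite: Rogawski1990, §1.10, §7.3] -/
theorem unipotentIntegral_translate_eq_chi_mul_borelHeight_cpow_mul (hc : c * c = 1) (hcδ : c δ = -δ) (hδ : δ ≠ 0)
    (μF : Measure (AdeleRing (𝓞 F) F)) [μF.IsAddHaarMeasure] (μE : Measure (AdeleRing (𝓞 E) E)) [μE.IsAddHaarMeasure]
    (ν : Measure ↥(adelicUnipotent F E c 3)) [ν.IsHaarMeasure]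
    {𝓕 : Set ↥(adelicUnipotent F E c 3)} (h𝓕 : IsFundamentalDomain ↥(rationalUnipotent F E c 3) 𝓕 ν)
    (χ : HeckeCharacter E) (z : ℂ) {f : (quasiSplit F E c 3).Adelic → ℂ}
    (hf : ∀ (b g : (quasiSplit F E c 3).Adelic) (hb : b ∈ borelAdelic F E c 3),
      f (b * g) = ((χ (diagUnit hb 0) : ℂˣ) : ℂ) * ((ideleNorm (diagUnit hb 0) : ℝ) : ℂ) ^ z * f g)
    (t : ↥(torusInBorel F E c 3)) (u : ↥(adelicUnipotent F E c 3)) {k : (quasiSplit F E c 3).Adelic} (hk : borelHeight k = 1)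
    (hT₁ : Integrable (fun n : ↥(adelicUnipotent F E c 3) =>
      f ((quasiSplit F E c 3).toAdelic (weylLongU (c : E →+* E) (rfl : (StdForm.antidiagonal 3).over E = (StdForm.antidiagonal 3).over E)) * (n : (quasiSplit F E c 3).Adelic) *
        ((u : (quasiSplit F E c 3).Adelic) * ((t : borelAdelic F E c 3) : (quasiSplit F E c 3).Adelic) * k))) ν)
    (hT₂ : Integrable (fun n : ↥(adelicUnipotent F E c 3) =>
      f ((quasiSplit F E c 3).toAdelic (weylLongU (c : E →+* E) (rfl : (StdForm.antidiagonal 3).over E = (StdForm.antidiagonal 3).over E)) * (n : (quasiSplit F E c 3).Adelic) * k)) ν) :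
    ((ν 𝓕).toReal⁻¹ : ℝ) • ∫ n : ↥(adelicUnipotent F E c 3),
        f ((quasiSplit F E c 3).toAdelic (weylLongU (c : E →+* E) (rfl : (StdForm.antidiagonal 3).over E = (StdForm.antidiagonal 3).over E)) * (n : (quasiSplit F E c 3).Adelic) *
          ((u : (quasiSplit F E c 3).Adelic) * ((t : borelAdelic F E c 3) : (quasiSplit F E c 3).Adelic) * k)) ∂ν =
      ((χ (diagUnit (t : borelAdelic F E c 3).2 2) : ℂˣ) : ℂ) *
        (((borelHeight ((u : (quasiSplit F E c 3).Adelic) * ((t : borelAdelic F E c 3) : (quasiSplit F E c 3).Adelic) * k) : ℝ≥0) : ℝ) : ℂ) ^ ((2 : ℂ) - z) *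
        (((ν 𝓕).toReal⁻¹ : ℝ) • ∫ n : ↥(adelicUnipotent F E c 3),
          f ((quasiSplit F E c 3).toAdelic (weylLongU (c : E →+* E) (rfl : (StdForm.antidiagonal 3).over E = (StdForm.antidiagonal 3).over E)) * (n : (quasiSplit F E c 3).Adelic) * k) ∂ν) := by
  obtain ⟨Λ₂, hΛ₂⟩ := exists_centralScalar_three hcδ hδ t
  have hH : borelHeight ((u : (quasiSplit F E c 3).Adelic) * ((t : borelAdelic F E c 3) : (quasiSplit F E c 3).Adelic) * k) =
      IdeleClassGroup.ideleNorm E (diagUnit (t : borelAdelic F E c 3).2 0) := by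
    rw [mul_assoc, borelHeight_unipotent_mul u.2, borelHeight_torus_mul' (glDiagonal_diagUnit_torus t) k, hk, mul_one]
  rw [unipotentIntegral_translate_eq' hc hcδ hδ μF μE ν h𝓕 χ z hf t Λ₂ hΛ₂ u k hT₁ hT₂, translatePrefactor_eq_chi_mul_cpow χ z t Λ₂ hΛ₂, hH]

/-- **THE `hψ2`-TYPE ROW OF EVERY TRANSLATE FROM THE `K`-TRANSLATES'** (hypothesis-first on Iwasawa data `g = u(g)·t(g)·k(g)` with `H(k(g)) = 1` and on the family `f z` of Borel
sections, e.g. `f z = flatSectionU φ z`): if `(ν𝓕)⁻¹ • ∫_N f_z(w₀·n·k(g)) dν = A(k(g), z)·c(z)` on `S`, then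
`((ν𝓕)⁻¹ • ∫_N f_z(w₀·n·g) dν) ∕ H(g)^{2−z} = (χ(d₂(t(g)))·A(k(g), z))·c(z)` on `S` — the amplitude of `g` is the unitary constant `χ(d₂(t(g)))` times the amplitude of
`k(g)`. [cite: MoeglinWaldspurger1995, II.1.7, IV.1.11] [cite: Garrett2018, §2.9] -/
theorem normalisedMidCoefficient_eq_of_kTranslates (hc : c * c = 1) (hcδ : c δ = -δ) (hδ : δ ≠ 0)
    (μF : Measure (AdeleRing (𝓞 F) F)) [μF.IsAddHaarMeasure] (μE : Measure (AdeleRing (𝓞 E) E)) [μE.IsAddHaarMeasure]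
    (ν : Measure ↥(adelicUnipotent F E c 3)) [ν.IsHaarMeasure]
    {𝓕 : Set ↥(adelicUnipotent F E c 3)} (h𝓕 : IsFundamentalDomain ↥(rationalUnipotent F E c 3) 𝓕 ν)
    (χ : HeckeCharacter E) {S : Set ℂ} {f : ℂ → (quasiSplit F E c 3).Adelic → ℂ}
    (hf : ∀ z ∈ S, ∀ (b g : (quasiSplit F E c 3).Adelic) (hb : b ∈ borelAdelic F E c 3),
      f z (b * g) = ((χ (diagUnit hb 0) : ℂˣ) : ℂ) * ((ideleNorm (diagUnit hb 0) : ℝ) : ℂ) ^ z * f z g)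
    (uι : (quasiSplit F E c 3).Adelic → ↥(adelicUnipotent F E c 3)) (tι : (quasiSplit F E c 3).Adelic → ↥(torusInBorel F E c 3))
    (kι : (quasiSplit F E c 3).Adelic → (quasiSplit F E c 3).Adelic)
    (hg : ∀ g, (uι g : (quasiSplit F E c 3).Adelic) * ((tι g : borelAdelic F E c 3) : (quasiSplit F E c 3).Adelic) * kι g = g) (hkH : ∀ g, borelHeight (kι g) = 1)
    (hT : ∀ z ∈ S, ∀ g : (quasiSplit F E c 3).Adelic, Integrable (fun n : ↥(adelicUnipotent F E c 3) =>
      f z ((quasiSplit F E c 3).toAdelic (weylLongU (c : E →+* E) (rfl : (StdForm.antidiagonal 3).over E = (StdForm.antidiagonal 3).over E)) * (n : (quasiSplit F E c 3).Adelic) * g)) ν)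
    (Ak : (quasiSplit F E c 3).Adelic → ℂ → ℂ) (cS : ℂ → ℂ)
    (hK : ∀ z ∈ S, ∀ g : (quasiSplit F E c 3).Adelic, ((ν 𝓕).toReal⁻¹ : ℝ) • ∫ n : ↥(adelicUnipotent F E c 3),
      f z ((quasiSplit F E c 3).toAdelic (weylLongU (c : E →+* E) (rfl : (StdForm.antidiagonal 3).over E = (StdForm.antidiagonal 3).over E)) * (n : (quasiSplit F E c 3).Adelic) * kι g) ∂ν =
        Ak (kι g) z * cS z)
    (z : ℂ) (hz : z ∈ S) (g : (quasiSplit F E c 3).Adelic) :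
    (((ν 𝓕).toReal⁻¹ : ℝ) • ∫ n : ↥(adelicUnipotent F E c 3),
        f z ((quasiSplit F E c 3).toAdelic (weylLongU (c : E →+* E) (rfl : (StdForm.antidiagonal 3).over E = (StdForm.antidiagonal 3).over E)) * (n : (quasiSplit F E c 3).Adelic) * g) ∂ν) /
        (((borelHeight g : ℝ≥0) : ℝ) : ℂ) ^ ((2 : ℂ) - z) =
      (((χ (diagUnit ((tι g : borelAdelic F E c 3)).2 2) : ℂˣ) : ℂ) * Ak (kι g) z) * cS z := by
  have h := unipotentIntegral_translate_eq_chi_mul_borelHeight_cpow_mul hc hcδ hδ μF μE ν h𝓕 χ z (hf z hz) (tι g) (uι g) (hkH g)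
    (by rw [hg g]; exact hT z hz g) (hT z hz (kι g))
  rw [hg g] at h
  have hH0 : (((borelHeight g : ℝ≥0) : ℝ) : ℂ) ^ ((2 : ℂ) - z) ≠ 0 := fun h0 =>
    absurd ((Complex.cpow_eq_zero_iff _ _).1 h0).1 (by exact_mod_cast (borelHeight_pos g).ne')
  rw [div_eq_iff hH0, h, hK z hz g]
  ring

omit [Algebra.IsQuadraticExtension F E] [MeasurableSpace (AdeleRing (𝓞 E) E)] [BorelSpace (AdeleRing (𝓞 E) E)] [MeasurableSpace (AdeleRing (𝓞 F) F)]
  [BorelSpace (AdeleRing (𝓞 F) F)] [MeasurableSpace ↥(adelicUnipotent F E c 3)] [BorelSpace ↥(adelicUnipotent F E c 3)] in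
/-- **THE HOLOMORPHY AND UNIFORM-BOUND ROWS OF EVERY TRANSLATE FROM THE `K`-TRANSLATES'** (`hAg`, `hM` of ★ `scalPackage_of_inputs` with `Ag g z := χ(d₂(t(g)))·A(k(g), z)`): holomorphy
is preserved by the constant `χ(d₂(t(g)))` and the bound by its unitarity `‖χ(d₂)‖ = 1`. [cite: MoeglinWaldspurger1995, IV.1.11] -/
theorem translate_rows_of_kTranslate_rows (χ : HeckeCharacter E) (hχ : χ.IsUnitary)
    (tι : (quasiSplit F E c 3).Adelic → ↥(torusInBorel F E c 3)) (kι : (quasiSplit F E c 3).Adelic → (quasiSplit F E c 3).Adelic)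
    (Ak : (quasiSplit F E c 3).Adelic → ℂ → ℂ) {S : Set ℂ} (hAk : ∀ g, DifferentiableOn ℂ (Ak (kι g)) S) {z₀ : ℂ} {M : ℝ} (hMk : ∀ g, ‖Ak (kι g) z₀‖ ≤ M) :
    (∀ g, DifferentiableOn ℂ (fun z => ((χ (diagUnit ((tι g : borelAdelic F E c 3)).2 2) : ℂˣ) : ℂ) * Ak (kι g) z) S) ∧
      ∀ g, ‖((χ (diagUnit ((tι g : borelAdelic F E c 3)).2 2) : ℂˣ) : ℂ) * Ak (kι g) z₀‖ ≤ M := by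
  refine ⟨fun g => (hAk g).const_mul _, fun g => ?_⟩
  rw [norm_mul, hχ, one_mul]
  exact hMk g

end Rows

end Summit.HodgeConjecture.HodgeConjecture.Cruxes.H413.K2E1ChiIntertwiningTranslateDilationU3

end
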